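import Literature.NumberTheory.GaloisRepresentations.IdeleSUnitsRep
import Literature.NumberTheory.GaloisRepresentations.IdeleClassInvariant
import Literature.NumberTheory.GaloisRepresentations.IdeleLocalInvariantsPlaceSum
import Literature.Algebra.Homology.ClassModuleCohomologyShift
import Mathlib.RepresentationTheory.Homological.GroupCohomology.LongExactSequence
import HarnessLib

/-!
# The `S`-unit / `S`-idèle / idèle-class sequence `0 → 𝒪_{E,S}ˣ → J_{E,S} → C_E → Cl_S(E) → 0` of a finite Galois
# layer, its two short exact pieces in `Rep ℤ Gal(E/F)`, and their long exact cohomology sequences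
# (Neukirch–Schmidt–Wingberg (8.3.9)–(8.3.11), finite level; Harari Lemma 15.39; Tate, C–F VII §8, §11.2)

Topic `NumberTheory/GaloisRepresentations` (cohomology of the idèles of a Galois extension of number fields);
namespace `Literature.NumberTheory.GaloisRepresentations.IdeleCohomology`, continuing `IdeleSUnitsRep.lean` (Tate's
`S`-idèles `J_{E,S} = ideleS F E S`, `ideleSRep F E S : Rep ℤ Gal(E/F)`, `ideleSRepHom S : J_{E,S} ↪ J_E`) and the tree's
`Automorphic/IdeleGaloisRep.lean` (`classRepHom F E : J_E ⟶ C_E`, `galoisRep F E` = `C_E`).  Definitions with bodies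
(concrete sub- and quotient representations via Mathlib's `Representation.subrepresentation` / `Representation.quotient`,
their structure maps, two short complexes) and theorems; NO named fact, no `sorry`, no instance, no notation; number
fields in `Type` (Mathlib's `groupCohomology` wants coefficients, group and module in one universe).

Mathematics (NSW VIII §3; Harari §15.5, §17.4; Tate, C–F VII §8).  For a finite Galois extension `E/F` of number fields
with group `G` and a finite set `S` of finite places of `F` (the archimedean places impose no condition), the composite
`J_{E,S} ↪ J_E ↠ C_E = J_E/Eˣ` of `G`-modules has KERNEL `J_{E,S} ∩ Eˣ = 𝒪_{E,S}ˣ` (the `S`-units, as principal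
idèles), IMAGE `J_{E,S}Eˣ/Eˣ ≅ J_{E,S}/𝒪_{E,S}ˣ` (Harari's `C_{E,S}`, Lemma 15.39) and COKERNEL
`J_E/(J_{E,S}·Eˣ) ≅ Cl_S(E)`, the `S`-ideal class group (Harari Lemma 15.39: "this cokernel is isomorphic to the ideal
class group of `𝒪_{F,S}`"; only the idelic description is used and recorded here).  The 4-term exact sequence of
`G`-modules `0 → 𝒪_{E,S}ˣ → J_{E,S} → C_E → Cl_S(E) → 0` splits into the two short exact sequences

  (A) `0 → 𝒪_{E,S}ˣ → J_{E,S} → J_{E,S}Eˣ/Eˣ → 0`,   (B) `0 → J_{E,S}Eˣ/Eˣ → C_E → Cl_S(E) → 0`,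

whose long exact cohomology sequences (Mathlib `groupCohomology.δ`, `mapShortComplex₁/₂/₃_exact`), together with the
class-formation facts `H¹(G, C_E) = 0` (tree `IdeleClassGroup.isZero_H1_galoisRep`) and `H³(G, C_E) = 0` (Tate's
theorem for the class module `C_E`, tree `IdeleClassGroup.exists_isClassModule_galoisRep_all`), are the finite-level
frame of NSW's computation of `Hⁱ(G_S, 𝒪_S^×)` ((8.3.11)): e.g. `H¹(G, Cl_S(E)) ↪ H²(G, J_{E,S}Eˣ/Eˣ)`,
`H²(G, Cl_S(E)) ↠ H³(G, J_{E,S}Eˣ/Eˣ)`, and `H²(G, J_{E,S}Eˣ/Eˣ) ↠ H³(G, 𝒪_{E,S}ˣ)` as soon as `H³(G, J_{E,S}) = 0`.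
On `H²` the composite `H²(G, J_{E,S}) → H²(G, C_E) →inv_{E/F}→ ℚ/ℤ` is the sum of the local invariants (tree
`classInvAll_ideleToClass`, Tate VII §11.2 `β₁(ε₁ b) = inv₁(b)`).

## What is formalised (`F E : Type` number fields, `G = E ≃ₐ[F] E`, `S : Finset (HeightOneSpectrum (𝓞 F))`)

* §1 `ideleSToClass S : ideleSRep F E S ⟶ galoisRep F E` (`J_{E,S} → C_E`), `ideleSToClass_hom_apply`,
  `ideleSToClass_hom_apply_eq_zero_iff` (the class of an `S`-idèle dies iff the idèle is principal).
* §2 the kernel: `sUnitsIdeleSubmodule S` (`= ker`), `sUnitsIdeleRep F E S` (`𝒪_{E,S}ˣ` as the principal `S`-idèles),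
  `sUnitsIdeleι S` (injective); the lift `sUnitsIdeleLift u hu` of any `u : X ⟶ J_{E,S}` dying in `C_E`, and
  `isIso_sUnitsIdeleLift` (universal property: any injective `u` onto the principal `S`-idèles is isomorphic to it).
* §3 the image: `ideleSClassSubmodule S` (`= range`), `ideleSClassRep F E S` (`J_{E,S}Eˣ/Eˣ ≤ C_E`), `ideleSClassι S`
  (injective), `ideleSToIdeleSClass S` (surjective), `ideleSToIdeleSClass_comp_ι`.
* §4 the cokernel: `sClassGroupRep F E S` (`Cl_S(E) = C_E/(J_{E,S}Eˣ/Eˣ)`), `sClassGroupπ S` (surjective),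
  `sClassGroupπ_hom_apply_eq_zero_iff`, `ideleSToClass_comp_sClassGroupπ`.
* §5 the two short exact sequences `sUnitsShortComplex S` (A), `sClassShortComplex S` (B) and their `ShortExact` proofs.
* §6 cohomology: `isZero_H3_galoisRep`; `mono_δ_sClass_one`, `epi_δ_sClass_zero`, `epi_δ_sClass_two`,
  `epi_δ_sUnits_two`; the `H²` readout `map_ideleSToClass_two`, `classInvAll_map_ideleSToClass`,
  `classInvAll_map_ideleSToClass_eq_sum`.

Not here: the identification of `sUnitsIdeleRep` with the abstract `S`-unit group `𝒪_{E,S}ˣ ≤ Eˣ` and of `sClassGroupRep`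
with the `S`-ideal class group; the layer-change (inflation) morphisms of the sequence in a tower `F ⊆ E ⊆ E'`; the
cohomology of `J_{E,S}` itself (blocks, `IdeleSUnitsCohomology.lean`).

## References
* J. Neukirch, A. Schmidt, K. Wingberg, *Cohomology of Number Fields*, 2nd ed. (2008), VIII §3, (8.3.9)–(8.3.11).
  [NeukirchSchmidtWingberg2008]
* D. Harari, *Galois Cohomology and Class Field Theory*, Universitext, Springer (2020), Def. 15.38, Lemma 15.39,
  §17.4 (17.1). [Harari2020]
* J. W. S. Cassels, A. Fröhlich (eds.), *Algebraic Number Theory* (1967), Ch. VII (J. Tate) §8, §11.2.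
  [CasselsFrohlichANT1967]
-/

noncomputable section

open NumberField IsDedekindDomain CategoryTheory CategoryTheory.Limits groupCohomology
open Literature.NumberTheory.Automorphic

namespace Literature.NumberTheory.GaloisRepresentations

namespace IdeleCohomology

open Literature.Algebra.Homology

universe u in
/-- A short complex of representations whose maps are injective / exact / surjective on elements is short exact
(exactness is reflected by the faithful forgetful functor to `k`-modules). [folklore] -/
private theorem shortExact_of_apply {k G : Type u} [CommRing k] [Group G] (X : ShortComplex (Rep.{u} k G))
    (hinj : Function.Injective X.f.hom) (hsurj : Function.Surjective X.g.hom)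
    (hex : ∀ x, X.g.hom x = 0 → ∃ y, X.f.hom y = x) : X.ShortExact where
  exact := by
    apply (forget₂ (Rep k G) (ModuleCat k)).reflects_exact_of_faithful
    rw [ShortComplex.moduleCat_exact_iff]
    exact hex
  mono_f := (Rep.mono_iff_injective _).2 hinj
  epi_g := (Rep.epi_iff_surjective _).2 hsurj

variable {F : Type} [Field F] [NumberField F] {E : Type} [Field E] [NumberField E] [Algebra F E]
variable (S : Finset (HeightOneSpectrum (𝓞 F)))

/-! ## §1. `J_{E,S} → C_E` -/

/-- **`J_{E,S} → C_E`**: the inclusion `J_{E,S} ↪ J_E` followed by the class map `J_E ↠ C_E = J_E/Eˣ`, a morphism of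
`Rep ℤ Gal(E/F)`. [cite: Harari2020, Lemma 15.39][cite: NeukirchSchmidtWingberg2008, VIII §3 (8.3.9)] -/
def ideleSToClass : ideleSRep F E S ⟶ IdeleClassGroup.galoisRep F E :=
  ideleSRepHom S ≫ IdeleClassGroup.classRepHom F E

/-- Unfolding: the class of the `S`-idèle `x` is `[x] ∈ C_E`. [cite: Harari2020, Lemma 15.39] -/
theorem ideleSToClass_hom_apply (x : (ideleSRep F E S).V) :
    (ideleSToClass S).hom x =
      Additive.ofMul (((Additive.toMul x : ideleS F E S) : ideleGroup E) : IdeleClassGroup E) := rfl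

/-- **An `S`-idèle has trivial class iff it is a principal idèle** (`ker (J_{E,S} → C_E) = J_{E,S} ∩ Eˣ`).
[cite: Harari2020, Lemma 15.39 (proof)][cite: NeukirchSchmidtWingberg2008, VIII §3 (8.3.9)] -/
theorem ideleSToClass_hom_apply_eq_zero_iff (x : (ideleSRep F E S).V) :
    (ideleSToClass S).hom x = 0 ↔ ((Additive.toMul x : ideleS F E S) : ideleGroup E) ∈ principalIdeles E := by
  rw [ideleSToClass_hom_apply, ← QuotientGroup.eq_one_iff]
  exact ⟨fun h => congrArg Additive.toMul h, fun h => congrArg Additive.ofMul h⟩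

/-! ## §2. The kernel `𝒪_{E,S}ˣ` (as the principal `S`-idèles) -/

variable (F E) in
/-- **The principal `S`-idèles `J_{E,S} ∩ Eˣ ≅ 𝒪_{E,S}ˣ`** as a submodule of `J_{E,S}`: the kernel of `J_{E,S} → C_E`.
[cite: Harari2020, Lemma 15.39 (proof: `J_{F,S} ∩ (F^*·U_{F,S}) = i(𝒪_{F,S}^*)`)] -/
def sUnitsIdeleSubmodule :=
  LinearMap.ker (ideleSToClass (F := F) (E := E) S).hom.toLinearMap

/-- Membership in the kernel submodule. [cite: Harari2020, Lemma 15.39] -/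
theorem mem_sUnitsIdeleSubmodule_iff (x : (ideleSRep F E S).V) :
    x ∈ sUnitsIdeleSubmodule F E S ↔ (ideleSToClass S).hom x = 0 := Iff.rfl

/-- Membership in the kernel submodule, idelically: the underlying idèle is principal. [cite: Harari2020, Lemma 15.39] -/
theorem mem_sUnitsIdeleSubmodule_iff_mem_principalIdeles (x : (ideleSRep F E S).V) :
    x ∈ sUnitsIdeleSubmodule F E S ↔ ((Additive.toMul x : ideleS F E S) : ideleGroup E) ∈ principalIdeles E :=
  ideleSToClass_hom_apply_eq_zero_iff S x

/-- The kernel submodule is `Gal(E/F)`-stable. [cite: NeukirchSchmidtWingberg2008, VIII §3 (8.3.9)] -/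
theorem sUnitsIdeleSubmodule_le_comap (g : E ≃ₐ[F] E) :
    sUnitsIdeleSubmodule F E S ≤ (sUnitsIdeleSubmodule F E S).comap ((ideleSRep F E S).ρ g) := by
  intro x hx
  change (ideleSToClass S).hom ((ideleSRep F E S).ρ g x) = 0
  rw [Rep.hom_comm_apply, (mem_sUnitsIdeleSubmodule_iff S x).1 hx, map_zero]

variable (F E) in
/-- **`𝒪_{E,S}ˣ` as a `Gal(E/F)`-module, realised as the principal `S`-idèles** (the subrepresentation of `J_{E,S}` on
the kernel of `J_{E,S} → C_E`). [cite: NeukirchSchmidtWingberg2008, VIII §3 (8.3.9)][cite: Harari2020, Lemma 15.39] -/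
def sUnitsIdeleRep : Rep ℤ (E ≃ₐ[F] E) :=
  Rep.of ((ideleSRep F E S).ρ.subrepresentation (sUnitsIdeleSubmodule F E S) (sUnitsIdeleSubmodule_le_comap S))

/-- **`𝒪_{E,S}ˣ ↪ J_{E,S}`** (the inclusion of the principal `S`-idèles), a morphism of `Rep ℤ Gal(E/F)`.
[cite: NeukirchSchmidtWingberg2008, VIII §3 (8.3.9)] -/
def sUnitsIdeleι : sUnitsIdeleRep F E S ⟶ ideleSRep F E S :=
  Rep.ofHom (LinearMap.intertwiningMap_of_isIntertwiningMap (sUnitsIdeleRep F E S).ρ (ideleSRep F E S).ρ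
    (sUnitsIdeleSubmodule F E S).subtype fun _ _ => rfl)

/-- Unfolding: `sUnitsIdeleι` is the subtype inclusion. [cite: NeukirchSchmidtWingberg2008, VIII §3 (8.3.9)] -/
theorem sUnitsIdeleι_hom_apply (x : sUnitsIdeleSubmodule F E S) :
    (sUnitsIdeleι S).hom x = (x : (ideleSRep F E S).V) := rfl

/-- `𝒪_{E,S}ˣ → J_{E,S}` is injective. [cite: NeukirchSchmidtWingberg2008, VIII §3 (8.3.9)] -/
theorem sUnitsIdeleι_injective : Function.Injective (sUnitsIdeleι (F := F) (E := E) S).hom :=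
  fun (_ _ : sUnitsIdeleSubmodule F E S) h => Subtype.ext h

/-- `𝒪_{E,S}ˣ → J_{E,S}` is a monomorphism. [cite: NeukirchSchmidtWingberg2008, VIII §3 (8.3.9)] -/
theorem mono_sUnitsIdeleι : Mono (sUnitsIdeleι (F := F) (E := E) S) :=
  (Rep.mono_iff_injective _).2 (sUnitsIdeleι_injective S)

/-- `𝒪_{E,S}ˣ → J_{E,S} → C_E` is zero. [cite: NeukirchSchmidtWingberg2008, VIII §3 (8.3.9)] -/
theorem sUnitsIdeleι_comp_ideleSToClass : sUnitsIdeleι S ≫ ideleSToClass (F := F) (E := E) S = 0 :=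
  Rep.hom_ext (Representation.IntertwiningMap.ext (LinearMap.ext fun (x : sUnitsIdeleSubmodule F E S) => x.2))

/-! ## §3. The image `J_{E,S}Eˣ/Eˣ ≤ C_E` -/

variable (F E) in
/-- **`J_{E,S}Eˣ/Eˣ`** as a submodule of `C_E`: the range of `J_{E,S} → C_E` (Harari's `C_{F,S} = J_{F,S}/𝒪_{F,S}^*`
embedded in `C_F` by `j`). [cite: Harari2020, Lemma 15.39][cite: NeukirchSchmidtWingberg2008, VIII §3 (8.3.9)] -/
def ideleSClassSubmodule :=
  LinearMap.range (ideleSToClass (F := F) (E := E) S).hom.toLinearMap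

/-- Membership in `J_{E,S}Eˣ/Eˣ`: the class is represented by an `S`-idèle. [cite: Harari2020, Lemma 15.39] -/
theorem mem_ideleSClassSubmodule_iff (y : (IdeleClassGroup.galoisRep F E).V) :
    y ∈ ideleSClassSubmodule F E S ↔ ∃ x : (ideleSRep F E S).V, (ideleSToClass S).hom x = y :=
  LinearMap.mem_range

/-- Membership in `J_{E,S}Eˣ/Eˣ`, idelically. [cite: Harari2020, Lemma 15.39] -/
theorem mem_ideleSClassSubmodule_iff_exists_mk_eq (y : (IdeleClassGroup.galoisRep F E).V) :
    y ∈ ideleSClassSubmodule F E S ↔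
      ∃ x : ideleS F E S, ((x : ideleGroup E) : IdeleClassGroup E) = Additive.toMul y := by
  rw [mem_ideleSClassSubmodule_iff]
  constructor
  · rintro ⟨x, rfl⟩
    exact ⟨Additive.toMul x, rfl⟩
  · rintro ⟨x, hx⟩
    exact ⟨Additive.ofMul x, (congrArg Additive.ofMul hx).trans rfl⟩

/-- `J_{E,S}Eˣ/Eˣ` is `Gal(E/F)`-stable. [cite: NeukirchSchmidtWingberg2008, VIII §3 (8.3.9)] -/
theorem ideleSClassSubmodule_le_comap (g : E ≃ₐ[F] E) :
    ideleSClassSubmodule F E S ≤ (ideleSClassSubmodule F E S).comap ((IdeleClassGroup.galoisRep F E).ρ g) := by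
  rintro _ ⟨x, rfl⟩
  change (IdeleClassGroup.galoisRep F E).ρ g ((ideleSToClass S).hom x) ∈ ideleSClassSubmodule F E S
  exact (mem_ideleSClassSubmodule_iff S _).2 ⟨(ideleSRep F E S).ρ g x, Rep.hom_comm_apply (ideleSToClass S) g x⟩

variable (F E) in
/-- **`J_{E,S}Eˣ/Eˣ` as a `Gal(E/F)`-module** (the subrepresentation of `C_E` on the range of `J_{E,S} → C_E`; Harari's
`C_{E,S}`). [cite: Harari2020, Lemma 15.39][cite: NeukirchSchmidtWingberg2008, VIII §3 (8.3.9)] -/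
def ideleSClassRep : Rep ℤ (E ≃ₐ[F] E) :=
  Rep.of ((IdeleClassGroup.galoisRep F E).ρ.subrepresentation (ideleSClassSubmodule F E S)
    (ideleSClassSubmodule_le_comap S))

/-- **`J_{E,S}Eˣ/Eˣ ↪ C_E`**, a morphism of `Rep ℤ Gal(E/F)`. [cite: Harari2020, Lemma 15.39 (the embedding `j`)] -/
def ideleSClassι : ideleSClassRep F E S ⟶ IdeleClassGroup.galoisRep F E :=
  Rep.ofHom (LinearMap.intertwiningMap_of_isIntertwiningMap (ideleSClassRep F E S).ρ (IdeleClassGroup.galoisRep F E).ρ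
    (ideleSClassSubmodule F E S).subtype fun _ _ => rfl)

/-- Unfolding: `ideleSClassι` is the subtype inclusion. [cite: Harari2020, Lemma 15.39] -/
theorem ideleSClassι_hom_apply (y : ideleSClassSubmodule F E S) :
    (ideleSClassι S).hom y = (y : (IdeleClassGroup.galoisRep F E).V) := rfl

/-- `J_{E,S}Eˣ/Eˣ → C_E` is injective. [cite: Harari2020, Lemma 15.39] -/
theorem ideleSClassι_injective : Function.Injective (ideleSClassι (F := F) (E := E) S).hom :=
  fun (_ _ : ideleSClassSubmodule F E S) h => Subtype.ext h

/-- `J_{E,S}Eˣ/Eˣ → C_E` is a monomorphism. [cite: Harari2020, Lemma 15.39] -/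
theorem mono_ideleSClassι : Mono (ideleSClassι (F := F) (E := E) S) :=
  (Rep.mono_iff_injective _).2 (ideleSClassι_injective S)

/-- **`J_{E,S} ↠ J_{E,S}Eˣ/Eˣ`** (range restriction of `J_{E,S} → C_E`), a morphism of `Rep ℤ Gal(E/F)`.
[cite: Harari2020, Lemma 15.39][cite: NeukirchSchmidtWingberg2008, VIII §3 (8.3.9)] -/
def ideleSToIdeleSClass : ideleSRep F E S ⟶ ideleSClassRep F E S :=
  Rep.ofHom (LinearMap.intertwiningMap_of_isIntertwiningMap (ideleSRep F E S).ρ (ideleSClassRep F E S).ρ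
    (LinearMap.rangeRestrict (ideleSToClass (F := F) (E := E) S).hom.toLinearMap)
    fun g x => Subtype.ext (Rep.hom_comm_apply (ideleSToClass S) g x))

/-- Unfolding of `ideleSToIdeleSClass` on values: followed by the inclusion it is `J_{E,S} → C_E`.
[cite: Harari2020, Lemma 15.39] -/
theorem ideleSClassι_hom_ideleSToIdeleSClass_hom_apply (x : (ideleSRep F E S).V) :
    (ideleSClassι S).hom ((ideleSToIdeleSClass S).hom x) = (ideleSToClass S).hom x := rfl

/-- `J_{E,S} → J_{E,S}Eˣ/Eˣ` is surjective. [cite: Harari2020, Lemma 15.39] -/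
theorem ideleSToIdeleSClass_surjective : Function.Surjective (ideleSToIdeleSClass (F := F) (E := E) S).hom :=
  fun (y : ideleSClassSubmodule F E S) => by
    obtain ⟨x, hx⟩ := (mem_ideleSClassSubmodule_iff S _).1 y.2
    exact ⟨x, Subtype.ext hx⟩

/-- **Factorisation `J_{E,S} ↠ J_{E,S}Eˣ/Eˣ ↪ C_E` of `J_{E,S} → C_E`.** [cite: Harari2020, Lemma 15.39] -/
theorem ideleSToIdeleSClass_comp_ι : ideleSToIdeleSClass S ≫ ideleSClassι S = ideleSToClass (F := F) (E := E) S :=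
  Rep.hom_ext (Representation.IntertwiningMap.ext (LinearMap.ext fun _ => rfl))

/-- `𝒪_{E,S}ˣ → J_{E,S} → J_{E,S}Eˣ/Eˣ` is zero. [cite: NeukirchSchmidtWingberg2008, VIII §3 (8.3.9)] -/
theorem sUnitsIdeleι_comp_ideleSToIdeleSClass : sUnitsIdeleι S ≫ ideleSToIdeleSClass (F := F) (E := E) S = 0 :=
  Rep.hom_ext (Representation.IntertwiningMap.ext (LinearMap.ext fun (x : sUnitsIdeleSubmodule F E S) =>
    Subtype.ext x.2))

/-! ## §4. The cokernel `Cl_S(E) = C_E/(J_{E,S}Eˣ/Eˣ) = J_E/(J_{E,S}·Eˣ)` -/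

variable (F E) in
/-- **`Cl_S(E)`, idelically: the `Gal(E/F)`-module `C_E/(J_{E,S}Eˣ/Eˣ) = J_E/(J_{E,S}·Eˣ)`** (the quotient
representation; isomorphic to the `S`-ideal class group of `E` — Harari Lemma 15.39 — an identification not used
here). [cite: Harari2020, Lemma 15.39][cite: NeukirchSchmidtWingberg2008, VIII §3 (8.3.9)] -/
def sClassGroupRep : Rep ℤ (E ≃ₐ[F] E) :=
  Rep.of ((IdeleClassGroup.galoisRep F E).ρ.quotient (ideleSClassSubmodule F E S) (ideleSClassSubmodule_le_comap S))

/-- **`C_E ↠ Cl_S(E)`**, a morphism of `Rep ℤ Gal(E/F)`. [cite: Harari2020, Lemma 15.39] -/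
def sClassGroupπ : IdeleClassGroup.galoisRep F E ⟶ sClassGroupRep F E S :=
  Rep.ofHom (LinearMap.intertwiningMap_of_isIntertwiningMap (IdeleClassGroup.galoisRep F E).ρ (sClassGroupRep F E S).ρ
    (ideleSClassSubmodule F E S).mkQ fun _ _ => rfl)

/-- Unfolding: `sClassGroupπ` is the quotient map. [cite: Harari2020, Lemma 15.39] -/
theorem sClassGroupπ_hom_apply (y : (IdeleClassGroup.galoisRep F E).V) :
    (sClassGroupπ S).hom y = (ideleSClassSubmodule F E S).mkQ y := rfl

/-- `C_E → Cl_S(E)` is surjective. [cite: Harari2020, Lemma 15.39] -/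
theorem sClassGroupπ_surjective : Function.Surjective (sClassGroupπ (F := F) (E := E) S).hom :=
  Submodule.mkQ_surjective (ideleSClassSubmodule F E S)

/-- **An idèle class dies in `Cl_S(E)` iff it lies in `J_{E,S}Eˣ/Eˣ`.** [cite: Harari2020, Lemma 15.39] -/
theorem sClassGroupπ_hom_apply_eq_zero_iff_mem (y : (IdeleClassGroup.galoisRep F E).V) :
    (sClassGroupπ S).hom y = 0 ↔ y ∈ ideleSClassSubmodule F E S :=
  Submodule.Quotient.mk_eq_zero (ideleSClassSubmodule F E S)

/-- **An idèle class dies in `Cl_S(E)` iff it is represented by an `S`-idèle.** [cite: Harari2020, Lemma 15.39] -/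
theorem sClassGroupπ_hom_apply_eq_zero_iff (y : (IdeleClassGroup.galoisRep F E).V) :
    (sClassGroupπ S).hom y = 0 ↔ ∃ x : ideleS F E S, ((x : ideleGroup E) : IdeleClassGroup E) = Additive.toMul y :=
  (sClassGroupπ_hom_apply_eq_zero_iff_mem S y).trans (mem_ideleSClassSubmodule_iff_exists_mk_eq S y)

/-- `J_{E,S}Eˣ/Eˣ → C_E → Cl_S(E)` is zero. [cite: Harari2020, Lemma 15.39] -/
theorem ideleSClassι_comp_sClassGroupπ : ideleSClassι S ≫ sClassGroupπ (F := F) (E := E) S = 0 :=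
  Rep.hom_ext (Representation.IntertwiningMap.ext (LinearMap.ext fun (y : ideleSClassSubmodule F E S) =>
    (Submodule.Quotient.mk_eq_zero _).2 y.2))

/-- `J_{E,S} → C_E → Cl_S(E)` is zero. [cite: Harari2020, Lemma 15.39] -/
theorem ideleSToClass_comp_sClassGroupπ : ideleSToClass S ≫ sClassGroupπ (F := F) (E := E) S = 0 := by
  rw [← ideleSToIdeleSClass_comp_ι, Category.assoc, ideleSClassι_comp_sClassGroupπ, comp_zero]

/-! ## §5. The two short exact sequences -/

/-- **(A) `𝒪_{E,S}ˣ → J_{E,S} → J_{E,S}Eˣ/Eˣ`** as a short complex of `Rep ℤ Gal(E/F)`.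
[cite: NeukirchSchmidtWingberg2008, VIII §3 (8.3.9)][cite: Harari2020, §17.4 (17.1)] -/
def sUnitsShortComplex : ShortComplex (Rep ℤ (E ≃ₐ[F] E)) :=
  ShortComplex.mk (sUnitsIdeleι (F := F) (E := E) S) (ideleSToIdeleSClass S)
    (sUnitsIdeleι_comp_ideleSToIdeleSClass S)

/-- **`0 → 𝒪_{E,S}ˣ → J_{E,S} → J_{E,S}Eˣ/Eˣ → 0` is short exact.** [cite: NeukirchSchmidtWingberg2008, VIII §3 (8.3.9)]
[cite: Harari2020, §17.4 (17.1)] -/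
theorem sUnitsShortComplex_shortExact : (sUnitsShortComplex (F := F) (E := E) S).ShortExact :=
  shortExact_of_apply _ (sUnitsIdeleι_injective S) (ideleSToIdeleSClass_surjective S) fun x hx =>
    ⟨(⟨x, (mem_sUnitsIdeleSubmodule_iff S x).2
      (congrArg (Subtype.val : ideleSClassSubmodule F E S → (IdeleClassGroup.galoisRep F E).V) hx)⟩ :
        sUnitsIdeleSubmodule F E S), rfl⟩

/-- **(B) `J_{E,S}Eˣ/Eˣ → C_E → Cl_S(E)`** as a short complex of `Rep ℤ Gal(E/F)`. [cite: Harari2020, Lemma 15.39]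
[cite: NeukirchSchmidtWingberg2008, VIII §3 (8.3.9)] -/
def sClassShortComplex : ShortComplex (Rep ℤ (E ≃ₐ[F] E)) :=
  ShortComplex.mk (ideleSClassι (F := F) (E := E) S) (sClassGroupπ S) (ideleSClassι_comp_sClassGroupπ S)

/-- **`0 → J_{E,S}Eˣ/Eˣ → C_E → Cl_S(E) → 0` is short exact.** [cite: Harari2020, Lemma 15.39]
[cite: NeukirchSchmidtWingberg2008, VIII §3 (8.3.9)] -/
theorem sClassShortComplex_shortExact : (sClassShortComplex (F := F) (E := E) S).ShortExact :=
  shortExact_of_apply _ (ideleSClassι_injective S) (sClassGroupπ_surjective S) fun y hy =>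
    ⟨(⟨y, (Submodule.Quotient.mk_eq_zero _).1 hy⟩ : ideleSClassSubmodule F E S), rfl⟩

/-- `X₁ = 𝒪_{E,S}ˣ`, `X₂ = J_{E,S}`, `X₃ = J_{E,S}Eˣ/Eˣ` (definitional). [cite: NeukirchSchmidtWingberg2008, VIII §3 (8.3.9)] -/
theorem sUnitsShortComplex_X₁ : (sUnitsShortComplex (F := F) (E := E) S).X₁ = sUnitsIdeleRep F E S := rfl

/-- `X₁ = J_{E,S}Eˣ/Eˣ`, `X₂ = C_E`, `X₃ = Cl_S(E)` (definitional). [cite: Harari2020, Lemma 15.39] -/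
theorem sClassShortComplex_X₃ : (sClassShortComplex (F := F) (E := E) S).X₃ = sClassGroupRep F E S := rfl

/-! ### The kernel universal property of `𝒪_{E,S}ˣ → J_{E,S}` (for other models of the `S`-units) -/

section Lift

variable {S}
variable {X : Rep ℤ (E ≃ₐ[F] E)}

/-- A morphism `u : X ⟶ J_{E,S}` dying in `C_E` dies in `J_{E,S}Eˣ/Eˣ` (`J_{E,S}Eˣ/Eˣ ↪ C_E` is a monomorphism).
[cite: Harari2020, Lemma 15.39 (proof: `J_{F,S} ∩ (F^*·U_{F,S}) = i(𝒪_{F,S}^*)`)] -/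
theorem comp_ideleSToIdeleSClass_eq_zero (u : X ⟶ ideleSRep F E S) (hu : u ≫ ideleSToClass S = 0) :
    u ≫ ideleSToIdeleSClass S = 0 := by
  haveI := mono_ideleSClassι (F := F) (E := E) S
  rw [← cancel_mono (ideleSClassι (F := F) (E := E) S), zero_comp, Category.assoc, ideleSToIdeleSClass_comp_ι, hu]

/-- **The lift `X ⟶ 𝒪_{E,S}ˣ` of a morphism `u : X ⟶ J_{E,S}` with `u ≫ (J_{E,S} → C_E) = 0`** (the kernel universal
property of the short exact sequence (A), Mathlib `ShortExact.fIsKernel`). [cite: Harari2020, Lemma 15.39 (proof: `J_{F,S} ∩ (F^*·U_{F,S}) = i(𝒪_{F,S}^*)`)] -/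
def sUnitsIdeleLift (u : X ⟶ ideleSRep F E S) (hu : u ≫ ideleSToClass S = 0) : X ⟶ sUnitsIdeleRep F E S :=
  (sUnitsShortComplex_shortExact (F := F) (E := E) S).fIsKernel.lift
    (KernelFork.ofι u (comp_ideleSToIdeleSClass_eq_zero u hu))

/-- The lift followed by the inclusion `𝒪_{E,S}ˣ ↪ J_{E,S}` is `u`. [cite: Harari2020, Lemma 15.39 (proof: `J_{F,S} ∩ (F^*·U_{F,S}) = i(𝒪_{F,S}^*)`)] -/
theorem sUnitsIdeleLift_comp_ι (u : X ⟶ ideleSRep F E S) (hu : u ≫ ideleSToClass S = 0) :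
    sUnitsIdeleLift u hu ≫ sUnitsIdeleι S = u :=
  (sUnitsShortComplex_shortExact (F := F) (E := E) S).fIsKernel.fac _ Limits.WalkingParallelPair.zero

/-- **Recognition**: an injective `u : X ⟶ J_{E,S}` dying in `C_E` whose range contains every principal `S`-idèle is
an isomorphism onto `sUnitsIdeleRep F E S` — so any other model of the `G`-module `𝒪_{E,S}ˣ` (e.g. the `S`-units of `E`
inside `Eˣ`, embedded by `a ↦ (a)`) is canonically isomorphic to this one over `J_{E,S}`. [cite: Harari2020, Lemma 15.39 (proof: `J_{F,S} ∩ (F^*·U_{F,S}) = i(𝒪_{F,S}^*)`)] -/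
theorem isIso_sUnitsIdeleLift (u : X ⟶ ideleSRep F E S) (hu : u ≫ ideleSToClass S = 0) [Mono u]
    (hsurj : ∀ x : (ideleSRep F E S).V, (ideleSToClass S).hom x = 0 → x ∈ Set.range u.hom) :
    IsIso (sUnitsIdeleLift u hu) := by
  haveI : Mono (sUnitsIdeleLift u hu) := mono_of_mono_fac (sUnitsIdeleLift_comp_ι u hu)
  haveI : Epi (sUnitsIdeleLift u hu) := (Rep.epi_iff_surjective _).2 fun (y : sUnitsIdeleSubmodule F E S) => by
    obtain ⟨x, hx⟩ := hsurj (y : (ideleSRep F E S).V) ((mem_sUnitsIdeleSubmodule_iff S _).1 y.2)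
    refine ⟨x, sUnitsIdeleι_injective S ?_⟩
    change (sUnitsIdeleLift u hu ≫ sUnitsIdeleι S).hom x = (sUnitsIdeleι S).hom y
    rw [sUnitsIdeleLift_comp_ι]
    exact hx
  exact isIso_of_mono_of_epi _

end Lift

/-! ## §6. Cohomology: the class-module inputs and the long exact sequences -/

section Cohomology

variable [IsGalois F E]

omit S in
/-- **`H³(Gal(E/F), C_E) = 0`** for every finite Galois extension of number fields: Tate's theorem for the class module
`(Gal(E/F), C_E)` (`H³(G, C_E) ≅ H¹(G, ℤ) = 0`; tree `exists_isClassModule_galoisRep_all` +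
`IsClassModule.isZero_groupCohomology_three`). [cite: CasselsFrohlichANT1967, Ch. VII §11.3 (Tate's theorem)]
[cite: NeukirchSchmidtWingberg2008, VIII §3 (8.3.11) (proof: `H³(G_S, C_S) = 0`)] -/
theorem isZero_H3_galoisRep : IsZero (groupCohomology (IdeleClassGroup.galoisRep F E) 3) := by
  obtain ⟨φ, hA⟩ := IdeleClassGroup.exists_isClassModule_galoisRep_all F E
  exact hA.isZero_groupCohomology_three

/-- **`H¹(G, Cl_S(E)) ↪ H²(G, J_{E,S}Eˣ/Eˣ)`**: the connecting map of (B) in degree `1` is injective, since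
`H¹(G, C_E) = 0`. [cite: NeukirchSchmidtWingberg2008, VIII §3 (8.3.11) (proof)] -/
theorem mono_δ_sClass_one : Mono (groupCohomology.δ (sClassShortComplex_shortExact (F := F) (E := E) S) 1 2 rfl) :=
  mono_δ_of_isZero _ 1 IdeleClassGroup.isZero_H1_galoisRep

/-- **`H⁰(G, Cl_S(E)) ↠ H¹(G, J_{E,S}Eˣ/Eˣ)`**: the connecting map of (B) in degree `0` is surjective, since
`H¹(G, C_E) = 0`. [cite: NeukirchSchmidtWingberg2008, VIII §3 (8.3.11) (proof)] -/
theorem epi_δ_sClass_zero : Epi (groupCohomology.δ (sClassShortComplex_shortExact (F := F) (E := E) S) 0 1 rfl) :=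
  epi_δ_of_isZero _ 0 IdeleClassGroup.isZero_H1_galoisRep

/-- **`H²(G, Cl_S(E)) ↠ H³(G, J_{E,S}Eˣ/Eˣ)`**: the connecting map of (B) in degree `2` is surjective, since
`H³(G, C_E) = 0`. [cite: NeukirchSchmidtWingberg2008, VIII §3 (8.3.11) (proof)] -/
theorem epi_δ_sClass_two : Epi (groupCohomology.δ (sClassShortComplex_shortExact (F := F) (E := E) S) 2 3 rfl) :=
  epi_δ_of_isZero _ 2 isZero_H3_galoisRep

omit [IsGalois F E] in
/-- **`H²(G, J_{E,S}Eˣ/Eˣ) ↠ H³(G, 𝒪_{E,S}ˣ)` as soon as `H³(G, J_{E,S}) = 0`** (the latter holds for `S ⊇` the ramified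
places over a totally complex `F`: `IdeleSUnitsCohomology`): the connecting map of (A) in degree `2`.
[cite: NeukirchSchmidtWingberg2008, VIII §3 (8.3.11) (iv) (proof)] -/
theorem epi_δ_sUnits_two (hJ3 : IsZero (groupCohomology (ideleSRep F E S) 3)) :
    Epi (groupCohomology.δ (sUnitsShortComplex_shortExact (F := F) (E := E) S) 2 3 rfl) :=
  epi_δ_of_isZero _ 2 hJ3

omit [IsGalois F E] in
/-- **Exactness at `H²(G, J_{E,S}Eˣ/Eˣ)` of (B)**: a class of `H²(G, J_{E,S}Eˣ/Eˣ)` dying in `H²(G, C_E)` is the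
connecting image of a class of `H¹(G, Cl_S(E))` (element form of Mathlib's `mapShortComplex₁_exact`).
[cite: NeukirchSchmidtWingberg2008, VIII §3 (8.3.11) (proof)] -/
theorem exists_δ_sClass_one_eq (y : groupCohomology (ideleSClassRep F E S) 2)
    (hy : groupCohomology.map (MonoidHom.id _) (ideleSClassι S) 2 y = 0) :
    ∃ w : groupCohomology (sClassGroupRep F E S) 1,
      groupCohomology.δ (sClassShortComplex_shortExact (F := F) (E := E) S) 1 2 rfl w = y := by
  have h := (mapShortComplex₁_exact (sClassShortComplex_shortExact (F := F) (E := E) S)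
    (i := 1) (j := 2) rfl).moduleCat_range_eq_ker
  have hy' : y ∈ LinearMap.ker (mapShortComplex₁ (sClassShortComplex_shortExact (F := F) (E := E) S)
      (i := 1) (j := 2) rfl).g.hom := hy
  rw [← h] at hy'
  exact hy'

omit [IsGalois F E] in
/-- **Exactness at `H²(G, J_{E,S})` of (A)**: a class of `H²(G, J_{E,S})` dying in `H²(G, J_{E,S}Eˣ/Eˣ)` comes from
`H²(G, 𝒪_{E,S}ˣ)` (element form of Mathlib's `mapShortComplex₂_exact`). [cite: NeukirchSchmidtWingberg2008, VIII §3 (8.3.11) (iii) (proof)] -/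
theorem exists_map_sUnitsIdeleι_two_eq (c : groupCohomology (ideleSRep F E S) 2)
    (hc : groupCohomology.map (MonoidHom.id _) (ideleSToIdeleSClass S) 2 c = 0) :
    ∃ x : groupCohomology (sUnitsIdeleRep F E S) 2, groupCohomology.map (MonoidHom.id _) (sUnitsIdeleι S) 2 x = c := by
  have h := (mapShortComplex₂_exact (sUnitsShortComplex_shortExact (F := F) (E := E) S) 2).moduleCat_range_eq_ker
  have hc' : c ∈ LinearMap.ker (mapShortComplex₂ (sUnitsShortComplex (F := F) (E := E) S) 2).g.hom := hc
  rw [← h] at hc'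
  exact hc'

omit [IsGalois F E] in
/-- **Exactness at `H³(G, 𝒪_{E,S}ˣ)` of (A)**: a class of `H³(G, 𝒪_{E,S}ˣ)` dying in `H³(G, J_{E,S})` is the connecting
image of a class of `H²(G, J_{E,S}Eˣ/Eˣ)`. [cite: NeukirchSchmidtWingberg2008, VIII §3 (8.3.11) (iv) (proof)] -/
theorem exists_δ_sUnits_two_eq (x : groupCohomology (sUnitsIdeleRep F E S) 3)
    (hx : groupCohomology.map (MonoidHom.id _) (sUnitsIdeleι S) 3 x = 0) :
    ∃ y : groupCohomology (ideleSClassRep F E S) 2,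
      groupCohomology.δ (sUnitsShortComplex_shortExact (F := F) (E := E) S) 2 3 rfl y = x := by
  have h := (mapShortComplex₁_exact (sUnitsShortComplex_shortExact (F := F) (E := E) S)
    (i := 2) (j := 3) rfl).moduleCat_range_eq_ker
  have hx' : x ∈ LinearMap.ker (mapShortComplex₁ (sUnitsShortComplex_shortExact (F := F) (E := E) S)
      (i := 2) (j := 3) rfl).g.hom := hx
  rw [← h] at hx'
  exact hx'

omit [IsGalois F E] in
/-- `H²(J_{E,S} → C_E) = H²(J_{E,S} ↪ J_E) ≫ H²(J_E → C_E)` (functoriality; the second map is the tree's `ideleToClass`).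
[cite: CasselsFrohlichANT1967, Ch. VII §11.2] -/
theorem map_ideleSToClass_two (c : groupCohomology (ideleSRep F E S) 2) :
    groupCohomology.map (MonoidHom.id _) (ideleSToClass S) 2 c =
      ideleToClass F E (groupCohomology.map (MonoidHom.id _) (ideleSRepHom S) 2 c) := by
  change ((groupCohomology.functor ℤ (E ≃ₐ[F] E) 2).map (ideleSRepHom S ≫ IdeleClassGroup.classRepHom F E)) c = _
  rw [Functor.map_comp]
  rfl

omit [IsGalois F E] in
/-- `H²(J_{E,S} → C_E) = H²(J_{E,S} ↠ J_{E,S}Eˣ/Eˣ) ≫ H²(J_{E,S}Eˣ/Eˣ ↪ C_E)` (functoriality of `H²` on the factorisation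
of §3). [cite: Harari2020, Lemma 15.39] -/
theorem map_ideleSToClass_two_eq_map_map (c : groupCohomology (ideleSRep F E S) 2) :
    groupCohomology.map (MonoidHom.id _) (ideleSToClass S) 2 c =
      groupCohomology.map (MonoidHom.id _) (ideleSClassι S) 2
        (groupCohomology.map (MonoidHom.id _) (ideleSToIdeleSClass S) 2 c) := by
  change ((groupCohomology.functor ℤ (E ≃ₐ[F] E) 2).map (ideleSToClass S)) c = _
  rw [← ideleSToIdeleSClass_comp_ι, Functor.map_comp]
  rfl

/-- **`inv_{E/F}` of the class of an `S`-idèle class is its total idèle invariant**: the composite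
`H²(G, J_{E,S}) → H²(G, C_E) →inv_{E/F}→ ℚ/ℤ` equals `inv = Σ_v inv_v` on `H²(G, J_E)` (tree `classInvAll_ideleToClass`,
Tate's `β₁(ε₁ b) = inv₁(b)`). [cite: CasselsFrohlichANT1967, Ch. VII §11.2 (bis)] -/
theorem classInvAll_map_ideleSToClass (c : groupCohomology (ideleSRep F E S) 2) :
    classInvAll F E (groupCohomology.map (MonoidHom.id _) (ideleSToClass S) 2 c) =
      inv E (groupCohomology.map (MonoidHom.id _) (ideleSRepHom S) 2 c) := by
  rw [map_ideleSToClass_two, classInvAll_ideleToClass]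

/-- **`inv_{E/F}(class of c) = Σ_{v ∈ S} inv_v(c)` over a totally complex base**, for a class `c ∈ H²(G, J_{E,S})` whose
invariants at the finite places outside `S` vanish (they do when `S ⊇` the ramified places: the off-`S` blocks of `J_{E,S}`
are cohomologically trivial, `IdeleSUnitsCohomology`); the archimedean invariants vanish over a totally complex `F`.
[cite: CasselsFrohlichANT1967, Ch. VII §11.2 (bis)][cite: NeukirchSchmidtWingberg2008, VIII §3 (8.3.10)–(8.3.11)] -/
theorem classInvAll_map_ideleSToClass_eq_sum [IsTotallyComplex F] (c : groupCohomology (ideleSRep F E S) 2)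
    (h : ∀ v : HeightOneSpectrum (𝓞 F), v ∉ S →
      localInv E v (groupCohomology.map (MonoidHom.id _) (ideleSRepHom S) 2 c) = 0) :
    classInvAll F E (groupCohomology.map (MonoidHom.id _) (ideleSToClass S) 2 c) =
      ∑ v ∈ S, localInv E v (groupCohomology.map (MonoidHom.id _) (ideleSRepHom S) 2 c) := by
  rw [classInvAll_map_ideleSToClass, inv_eq_sum _ S h,
    Finset.sum_eq_zero fun w _ => localInvInf_eq_zero_of_isTotallyComplex w _, add_zero]

end Cohomology

end IdeleCohomology

end Literature.NumberTheory.GaloisRepresentations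

end
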